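import Literature.Geometry.Kaehler.ComplexTorusEquivariantEndomorphismAlgebraBlocks
import Literature.Geometry.Kaehler.ComplexTorusAbelianGroupAction
import HarnessLib

/-!
# `End_ℚ^G = End_ℚ` on the fixed part: for a sub-torus `Y_W ⊆ X^G` the restricted action is trivial,
# `End_ℚ^G(Y_W) = End_ℚ(Y_W)`, `G`-simple ⟺ simple; `X^G` is the sum of the pointwise-fixed members of an
# equivariant Poincaré decomposition, whose blocks of `End_ℚ^G(X)` are full `M_{m_c}(End_ℚ(Y_{V_c}))`

Layer `Literature/Geometry/Kaehler`, namespace `Literature.Geometry.Kaehler.ComplexTorus`; lane `lit-hodgefound` (Track 2 foundations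
library), Layer A2, row «A2-26(cw)» (self-proposed 2026-08-27, prover seat `lit-hodgefound-p10`, generation 21, FILE 8 of the generation
«the algebra `End_ℚ^G(X)`»): the TRIVIAL ISOTYPICAL COMPONENT `A^G = Im(p_G)` seen from `End_ℚ^G(X)`.  CONSUMED BY NAME, nothing
restated: gen-1x's `fixedSubspace ρ H` / `idemSubspace_subgroupIdempotent` / `le_idemSubspace_subgroupIdempotent_iff` /
`groupAlgebraRep_subgroupIdempotent_top` (`A^H = Im ρ̄(p_H)`, "the maximal abelian subvariety on which `H` acts trivially"),
`Literature.RepresentationTheory.FiniteGroups.subgroupIdempotent` (`p_H`, `isIdempotentElem_subgroupIdempotent`,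
`subgroupIdempotent_mem_center`), gen-7's `restrictStable` / `subtorusMatrix_mulVec_restrictStable` / `IsSimpleSubtorus.isGSimpleSubtorus`,
FILE 1's `endAlgRatG_one`, FILE 2's `idem`, FILE 3's `endAlgRatGRep`, FILE 4's `classIdem` / `classIdem_mul_idem`, FILE 5's
`centerGroupAlgebraToCenter` / `idemSubspace_groupAlgebraRep_eq_biSup` / `groupAlgebraRep_mul_idem_eq_iff_of_isGIsogenousSub`, skel's
`idemSubspace` lemmas.

## Sources, VERBATIM (held texts; `p0NNN` = page file)

* A. Carocca, H. Lange, R. E. Rodríguez, *Abelian varieties with finite abelian group action* (2019), §4.1, p0006 (held; quoted in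
  `ComplexTorusAbelianGroupAction`): "`Im(p_H)` […] is the maximal abelian subvariety of `A` on which `H` acts trivially"; §5 Thm. 5.1
  ("`A^G` otherwise").
* H. Lange, R. E. Rodríguez, *Decomposition of Jacobians by Prym Varieties*, LNM 2310 (2022), §2.9.1 Thm. 2.9.1, p0043 (isotypical
  decomposition; the trivial representation `W_1` gives the component `A^{e_1}`), §3.5.2 Prop. 3.5.7, p0069 (`A^H`).
* H. Lange, S. Recillas, *Abelian varieties with group action* (2004), §1 (1.4) and Introduction (2), held `paper:arxiv-math_0106055` p0002:
  "`JX ∼ π^* JY × B_2^{n_2} × ⋯ × B_r^{n_r}`" (the component of the trivial representation `W_1`).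
* H. Lange, *Abelian Varieties over the Complex Numbers* (2023), §2.4.4 Cor. 2.4.26, p. 124.

## What is proved (torus level; theorems only; NO definition, NO named fact, no `sorry`)

* §1 (no polarisation) for a sub-torus `W ⊆ X^G` (`W ≤ fixedSubspace ρ ⊤`): `isStableSubspace_of_le_fixedSubspace` (every sub-torus of
  `X^G` is `G`-stable), **`isGSimpleSubtorus_iff_isSimpleSubtorus_of_le_fixedSubspace`** (`G`-simple ⟺ simple),
  **`restrictStable_eq_one_of_le_fixedSubspace`** (the restricted action on `Y_W` is trivial), **`endAlgRatG_restrictStable_eq_of_le_fixedSubspace`**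
  (`End_ℚ^G(Y_W) = End_ℚ(Y_W)`); for the fixed part `X^G = Im(ε_G)` itself (`G` finite): `idemSubspace_coe_groupAverage`
  (`Im(ε_G ⊗ ℝ) = fixedSubspace ρ ⊤`), `isComplexSubspace_fixedSubspace_top`, **`endAlgRatG_fixedPart_eq`** (`End_ℚ^G(X^G) = End_ℚ(X^G)`).
* §2 along an equivariant Poincaré decomposition `hd` (`G` finite): **`le_fixedSubspace_iff_groupAverage_mul_idem_eq`** (`Y_W ⊆ X^G ⟺
  ε_G ε_W = ε_W`), `le_fixedSubspace_iff_of_isGIsogenousSub` (constant on `G`-isogeny classes), **`fixedSubspace_top_eq_biSup`** (`X^G` is the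
  sum of the members fixed pointwise — the trivial isotypical component along Thm. 2.7.1), `le_fixedSubspace_iff_centerGroupAlgebraToCenter_mul_idem_eq`,
  **`centerGroupAlgebraToCenter_mul_classIdem_eq_iff`** (`ρ̄(p_G) E_c = E_c ⟺ V_c ⊆ X^G`), and for such classes **`endAlgRatGRep_eq_endAlgRat_of_le_fixedSubspace`** (the block's skew field is the
  FULL endomorphism algebra `D_c = End_ℚ(Y_{V_c})`, `V_c` simple: `isSimpleSubtorus_repOf_of_le_fixedSubspace`).

## References

* [CaroccaLangeRodriguez2019] A. Carocca, H. Lange, R. E. Rodríguez, *Abelian varieties with finite abelian group action* (2019), §4.1, §5 Thm. 5.1.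
* [LangeRodriguez2022] H. Lange, R. E. Rodríguez, *Decomposition of Jacobians by Prym Varieties*, LNM 2310 (2022), §2.7 Thm. 2.7.1, p. 38;
  §2.9.1 Thm. 2.9.1, p. 43; §3.5.2 Prop. 3.5.7, p. 69.
* [LangeRecillas2004] H. Lange, S. Recillas, *Abelian varieties with group action*, J. reine angew. Math. 575 (2004), §1 (1.4).
* [Lange2023AbelianVarietiesComplex] H. Lange, *Abelian Varieties over the Complex Numbers* (2023), §2.4.4 Cor. 2.4.26, p. 124.
-/

noncomputable section

open Module Function
open scoped Matrix

namespace Literature.Geometry.Kaehler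

namespace ComplexTorus

open Literature.RepresentationTheory.FiniteGroups

universe u

/-- Two matrices with the same action on vectors are equal. [folklore] -/
private theorem matrix_eq_of_mulVec_eq₂₅ {m : Type*} [Fintype m] [DecidableEq m] {R : Type*} [CommRing R]
    {M N : Matrix m m R} (h : ∀ v, M *ᵥ v = N *ᵥ v) : M = N := by
  ext i j
  have := congrFun (h (Pi.single j 1)) i
  rwa [Matrix.mulVec_single_one, Matrix.mulVec_single_one] at this

/-- `(A B) ⊗ ℝ = (A ⊗ ℝ)(B ⊗ ℝ)`. [folklore] -/
private theorem map_ratCast_mul₂₅ {ι : Type*} [Fintype ι] (A B : Matrix ι ι ℚ) :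
    (A * B).map (Rat.cast : ℚ → ℝ) = A.map (Rat.cast : ℚ → ℝ) * B.map (Rat.cast : ℚ → ℝ) :=
  Matrix.map_mul (f := Rat.castHom ℝ)

variable {ι : Type u} [Fintype ι] [DecidableEq ι] {E : Type*} [NormedAddCommGroup E] [NormedSpace ℂ E]
  {Φ : (ι → ℝ) ≃L[ℝ] E} {G : Type*} [Group G] (ρ : G →* endAlgRat Φ)

/-! ### §1 Sub-tori of the fixed part `X^G`: trivial restricted action, `End_ℚ^G = End_ℚ` -/

section FixedSubtorus

variable {W : Submodule ℝ (ι → ℝ)}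

/-- **Every sub-torus of `X^G` is `G`-stable** (`ρ(g) w = w ∈ W`). [cite: CaroccaLangeRodriguez2019, §4.1 ("on which `H` acts trivially"), p0006] -/
theorem isStableSubspace_of_le_fixedSubspace (h : W ≤ fixedSubspace ρ ⊤) : IsStableSubspace ρ W :=
  fun g w hw ↦ by rw [(h hw) g (Subgroup.mem_top g)]; exact hw

/-- **A sub-torus of `X^G` is `G`-simple iff it is simple** (all its sub-tori are `G`-stable).
[cite: LangeRodriguez2022, §2.7 (definition of `G`-simple; "For the special case `G = {1_A}` …"), p0038] [cite: CaroccaLangeRodriguez2019, §4.1, p0006] -/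
theorem isGSimpleSubtorus_iff_isSimpleSubtorus_of_le_fixedSubspace (h : W ≤ fixedSubspace ρ ⊤) :
    IsGSimpleSubtorus ρ W ↔ IsSimpleSubtorus Φ W :=
  ⟨fun hG ↦ ⟨hG.1, fun W' hW' hW'c hle ↦ hG.2 W' hW' hW'c (isStableSubspace_of_le_fixedSubspace ρ (hle.trans h)) hle⟩,
    fun hs ↦ hs.isGSimpleSubtorus ρ⟩

/-- **The restricted action on a sub-torus `Y_W ⊆ X^G` is TRIVIAL**: `ρ_W(g) = 1` for all `g` (`C_W ρ_W(g) y = ρ(g) C_W y = C_W y` and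
`R_W C_W = 1`). [cite: CaroccaLangeRodriguez2019, §4.1, p0006] [cite: LangeRodriguez2022, §3.5.2 Prop. 3.5.7, p0069] -/
theorem restrictStable_eq_one_of_le_fixedSubspace (hWL : IsLatticeSubspace W) (hWc : IsComplexSubspace Φ W)
    (hWs : IsStableSubspace ρ W) (h : W ≤ fixedSubspace ρ ⊤) : restrictStable ρ hWL hWc hWs = 1 := by
  ext g : 1
  apply Subtype.ext
  rw [MonoidHom.one_apply, OneMemClass.coe_one]
  apply Matrix.map_injective (Rat.cast_injective (α := ℝ))
  dsimp only
  rw [Matrix.map_one Rat.cast Rat.cast_zero Rat.cast_one]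
  refine matrix_eq_of_mulVec_eq₂₅ fun y ↦ ?_
  rw [Matrix.one_mulVec]
  have h1 := subtorusMatrix_mulVec_restrictStable ρ hWL hWc hWs g y
  rw [(h (subtorusMatrix_mulVec_mem W y)) g (Subgroup.mem_top g)] at h1
  have h2 := congrArg (fun v ↦ (retractionMatrix W).map (Int.cast : ℤ → ℝ) *ᵥ v) h1
  simpa only [retractionMatrix_mulVec_subtorusMatrix_mulVec] using h2

/-- **`End_ℚ^G(Y_W) = End_ℚ(Y_W)` for a sub-torus `Y_W ⊆ X^G`**: on the fixed part the equivariant endomorphism algebra is the whole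
endomorphism algebra (trivial restricted action; FILE 1's `endAlgRatG_one`). [cite: CaroccaLangeRodriguez2019, §4.1, p0006]
[cite: Lange2023AbelianVarietiesComplex, §2.4.4 Cor. 2.4.26, p. 124] -/
theorem endAlgRatG_restrictStable_eq_of_le_fixedSubspace (hWL : IsLatticeSubspace W) (hWc : IsComplexSubspace Φ W)
    (hWs : IsStableSubspace ρ W) (h : W ≤ fixedSubspace ρ ⊤) :
    endAlgRatG (subtorusPeriod Φ W hWL hWc) (restrictStable ρ hWL hWc hWs) = endAlgRat (subtorusPeriod Φ W hWL hWc) := by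
  rw [restrictStable_eq_one_of_le_fixedSubspace ρ hWL hWc hWs h, endAlgRatG_one]

end FixedSubtorus

section FixedPart

variable [Fintype G]

/-- **`Im(ε_G ⊗ ℝ) = X^G`**: the image of the averaging idempotent `ε_G = |G|⁻¹ Σ_g ρ(g)` is the fixed part (gen-1x's
`idemSubspace_subgroupIdempotent` for `H = G`, `ρ̄(p_G) = ε_G`). [cite: CaroccaLangeRodriguez2019, §5 Thm. 5.1 ("`A^G`"), p0007]
[cite: LangeRecillas2004, §1 (1.4), p0004] -/
theorem idemSubspace_coe_groupAverage : idemSubspace (groupAverage ρ : Matrix ι ι ℚ) = fixedSubspace ρ ⊤ := by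
  rw [← groupAlgebraRep_subgroupIdempotent_top, idemSubspace_subgroupIdempotent]

/-- `X^G` is a lattice subspace. [cite: CaroccaLangeRodriguez2019, §4.1 ("abelian subvariety `Im(p_H)`"), p0006] -/
theorem isLatticeSubspace_fixedSubspace_top : IsLatticeSubspace (fixedSubspace ρ ⊤) := by
  rw [← idemSubspace_coe_groupAverage ρ]
  exact isLatticeSubspace_idemSubspace _

/-- `X^G` is a complex subspace. [cite: CaroccaLangeRodriguez2019, §4.1, p0006] -/
theorem isComplexSubspace_fixedSubspace_top : IsComplexSubspace Φ (fixedSubspace ρ ⊤) := by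
  rw [← idemSubspace_coe_groupAverage ρ]
  exact isComplexSubspace_idemSubspace Φ (groupAverage ρ).2

omit [Fintype G] in
/-- `X^G` is `G`-stable. [cite: CaroccaLangeRodriguez2019, §4.1, p0006] -/
theorem isStableSubspace_fixedSubspace_top : IsStableSubspace ρ (fixedSubspace ρ ⊤) :=
  isStableSubspace_of_le_fixedSubspace ρ le_rfl

/-- **`End_ℚ^G(X^G) = End_ℚ(X^G)`**: on the fixed sub-torus `X^G` (with the restricted, trivial action) every endomorphism is
`G`-equivariant. [cite: CaroccaLangeRodriguez2019, §4.1 and §5 Thm. 5.1, pp. 6–7] [cite: Lange2023AbelianVarietiesComplex, §2.4.4 Cor. 2.4.26, p. 124] -/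
theorem endAlgRatG_fixedPart_eq :
    endAlgRatG (subtorusPeriod Φ (fixedSubspace ρ ⊤) (isLatticeSubspace_fixedSubspace_top ρ)
        (isComplexSubspace_fixedSubspace_top ρ))
      (restrictStable ρ (isLatticeSubspace_fixedSubspace_top ρ) (isComplexSubspace_fixedSubspace_top ρ)
        (isStableSubspace_fixedSubspace_top ρ)) =
      endAlgRat (subtorusPeriod Φ (fixedSubspace ρ ⊤) (isLatticeSubspace_fixedSubspace_top ρ)
        (isComplexSubspace_fixedSubspace_top ρ)) :=
  endAlgRatG_restrictStable_eq_of_le_fixedSubspace ρ _ _ _ le_rfl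

end FixedPart

/-! ### §2 Along an equivariant Poincaré decomposition: the pointwise-fixed members and their blocks -/

namespace IsEquivariantPoincareDecomposition

variable {ρ} [Fintype G] {η : E [⋀^Fin 2]→L[ℝ] ℝ} {s : Finset (Submodule ℝ (ι → ℝ))} (hd : IsEquivariantPoincareDecomposition Φ ρ η s)

/-- **`Y_W ⊆ X^G ⟺ ε_G ε_W = ε_W`** for a member `W` (`X^G = Im ε_G` is the maximal sub-torus on which `G` acts trivially; `Im ε_W = W`).
[cite: CaroccaLangeRodriguez2019, §4.1 ("the maximal abelian subvariety of `A` on which `H` acts trivially"), p0006]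
[cite: Lange2023AbelianVarietiesComplex, §2.4.3 Thm. 2.4.19, p. 121] -/
theorem le_fixedSubspace_iff_groupAverage_mul_idem_eq (W : s) :
    W.1 ≤ fixedSubspace ρ ⊤ ↔ (groupAverage ρ : Matrix ι ι ℚ) * (hd.idem W : Matrix ι ι ℚ) = hd.idem W := by
  have hW : idemSubspace (hd.idem W : Matrix ι ι ℚ) = W.1 := by
    rw [coe_idem_eq_symmIdempotent, idemSubspace_symmIdempotent]
  have havg : (groupAverage ρ : Matrix ι ι ℚ) * (groupAverage ρ : Matrix ι ι ℚ) = groupAverage ρ := by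
    rw [← Subalgebra.coe_mul, (isIdempotentElem_groupAverage ρ).eq]
  constructor
  · intro h
    apply Matrix.map_injective (Rat.cast_injective (α := ℝ))
    dsimp only
    refine matrix_eq_of_mulVec_eq₂₅ fun x ↦ ?_
    rw [map_ratCast_mul₂₅, ← Matrix.mulVec_mulVec]
    refine mulVec_of_mem_idemSubspace havg ?_
    rw [idemSubspace_coe_groupAverage]
    exact h (hd.idem_mulVec_mem W x)
  · intro h
    rw [← hW, ← idemSubspace_coe_groupAverage ρ]
    exact idemSubspace_le_of_mul_eq h

/-- The same in `End_ℚ^G(X)`: `Y_W ⊆ X^G ⟺ ρ̄(p_G) ε_W = ε_W` with FILE 5's central `ρ̄(p_G) ∈ Z(End_ℚ^G(X))`.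
[cite: CaroccaLangeRodriguez2019, §4.1, p0006] [cite: LangeRodriguez2022, §2.9.1 (2.27)–(2.28), p0043] -/
theorem le_fixedSubspace_iff_centerGroupAlgebraToCenter_mul_idem_eq (W : s) :
    W.1 ≤ fixedSubspace ρ ⊤ ↔
      (centerGroupAlgebraToCenter ρ ⟨subgroupIdempotent ⊤, subgroupIdempotent_mem_center ⊤⟩ : endAlgRatG Φ ρ) * hd.idem W =
        hd.idem W := by
  rw [hd.le_fixedSubspace_iff_groupAverage_mul_idem_eq W, ← groupAlgebraRep_subgroupIdempotent_top]
  exact ⟨fun h ↦ Subtype.ext h, fun h ↦ congrArg Subtype.val h⟩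

include hd in
/-- **Being inside `X^G` is a property of the `G`-isogeny class** (`V ∼_G W` members: `V ⊆ X^G ⟺ W ⊆ X^G`).
[cite: LangeRodriguez2022, §2.7 Thm. 2.7.1 and §2.9.1, pp. 38, 43] -/
theorem le_fixedSubspace_iff_of_isGIsogenousSub {V W : s} (h : IsGIsogenousSub ρ V.1 W.1) :
    V.1 ≤ fixedSubspace ρ ⊤ ↔ W.1 ≤ fixedSubspace ρ ⊤ := by
  rw [hd.le_fixedSubspace_iff_centerGroupAlgebraToCenter_mul_idem_eq V,
    hd.le_fixedSubspace_iff_centerGroupAlgebraToCenter_mul_idem_eq W]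
  exact hd.groupAlgebraRep_mul_idem_eq_iff_of_isGIsogenousSub
    (e := ⟨subgroupIdempotent ⊤, subgroupIdempotent_mem_center ⊤⟩) (isIdempotentElem_subgroupIdempotent ⊤) h

include hd in
/-- **`X^G = Σ_{W ∈ s, Y_W ⊆ X^G} W`: the fixed part is the sum of the members of the equivariant Poincaré decomposition on which `G`
acts trivially** — the trivial isotypical component `A^{e_1} = A^G` along Thm. 2.7.1 (FILE 5's `idemSubspace_groupAlgebraRep_eq_biSup` for
`e = p_G`). [cite: LangeRodriguez2022, §2.9.1 Thm. 2.9.1, p0043] [cite: LangeRecillas2004, §1 (1.4) and Introduction (2) ("`JX ∼ π^*JY × B_2^{n_2} × ⋯`"), pp. 2, 4]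
[cite: CaroccaLangeRodriguez2019, §5 Thm. 5.1, p0007] -/
theorem fixedSubspace_top_eq_biSup : fixedSubspace ρ ⊤ = ⨆ (W : s) (_ : W.1 ≤ fixedSubspace ρ ⊤), W.1 := by
  have h : idemSubspace ((groupAlgebraRep ρ (subgroupIdempotent ⊤) : endAlgRat Φ) : Matrix ι ι ℚ) =
      ⨆ (W : s) (_ : (centerGroupAlgebraToCenter ρ ⟨subgroupIdempotent ⊤, subgroupIdempotent_mem_center ⊤⟩ :
        endAlgRatG Φ ρ) * hd.idem W = hd.idem W), W.1 :=
    hd.idemSubspace_groupAlgebraRep_eq_biSup (e := ⟨subgroupIdempotent ⊤, subgroupIdempotent_mem_center ⊤⟩)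
      (isIdempotentElem_subgroupIdempotent ⊤)
  rw [groupAlgebraRep_subgroupIdempotent_top, idemSubspace_coe_groupAverage] at h
  exact h.trans (iSup_congr fun W ↦
    iSup_congr_Prop (hd.le_fixedSubspace_iff_centerGroupAlgebraToCenter_mul_idem_eq W).symm fun _ ↦ rfl)

/-- **`ρ̄(p_G) E_c = E_c ⟺ V_c ⊆ X^G`**: the classes inside the trivial isotypical component are exactly those of the pointwise-fixed
members. [cite: LangeRodriguez2022, §2.9.1 Thm. 2.9.1, p0043] [cite: CaroccaLangeRodriguez2019, §4.1, p0006] -/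
theorem centerGroupAlgebraToCenter_mul_classIdem_eq_iff (c : Fin hd.numClasses) :
    (centerGroupAlgebraToCenter ρ ⟨subgroupIdempotent ⊤, subgroupIdempotent_mem_center ⊤⟩ : endAlgRatG Φ ρ) * hd.classIdem c =
        hd.classIdem c ↔ (hd.repOf c).1 ≤ fixedSubspace ρ ⊤ := by
  rw [hd.le_fixedSubspace_iff_centerGroupAlgebraToCenter_mul_idem_eq (hd.repOf c)]
  constructor
  · intro h
    -- `z ε_V = z E_c ε_V = E_c ε_V = ε_V`
    have h1 : hd.classIdem c * hd.idem (hd.repOf c) = hd.idem (hd.repOf c) := by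
      rw [hd.classIdem_mul_idem, if_pos (hd.classOf_repOf c)]
    rw [← h1, ← mul_assoc, h]
  · intro h
    -- all members of the class are fixed, so `z E_c = Σ z ε_W = Σ ε_W = E_c`
    rw [IsEquivariantPoincareDecomposition.classIdem, Finset.mul_sum]
    refine Finset.sum_congr rfl fun W _ ↦ ?_
    have hW : hd.classOf W.1 = c := W.2
    exact (hd.groupAlgebraRep_mul_idem_eq_iff_of_isGIsogenousSub
      (e := ⟨subgroupIdempotent ⊤, subgroupIdempotent_mem_center ⊤⟩) (isIdempotentElem_subgroupIdempotent ⊤)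
      (hd.mem_fiber_iff.1 hW)).1 h

omit [Fintype G] in
/-- **On the classes inside `X^G` the block's skew field is the FULL endomorphism algebra: `D_c = End_ℚ^G(Y_{V_c}) = End_ℚ(Y_{V_c})`**
(and the block of `End_ℚ^G(X)` is `M_{m_c}(End_ℚ(Y_{V_c}))`, as in Cor. 2.4.26 without group).
[cite: Lange2023AbelianVarietiesComplex, §2.4.4 Cor. 2.4.26, p. 124] [cite: CaroccaLangeRodriguez2019, §4.1, p0006] -/
theorem endAlgRatGRep_eq_endAlgRat_of_le_fixedSubspace (c : Fin hd.numClasses) (h : (hd.repOf c).1 ≤ fixedSubspace ρ ⊤) :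
    hd.endAlgRatGRep c =
      endAlgRat (subtorusPeriod Φ (hd.repOf c).1 (hd.lattice' _ (hd.repOf c).2) (hd.complex' _ (hd.repOf c).2)) :=
  endAlgRatG_restrictStable_eq_of_le_fixedSubspace ρ _ _ _ h

omit [Fintype G] in
/-- … and the representative `V_c ⊆ X^G` is a SIMPLE sub-torus (not only `G`-simple). [cite: LangeRodriguez2022, §2.7, p0038]
[cite: Lange2023AbelianVarietiesComplex, §2.4.4 Thm. 2.4.25, p. 123] -/
theorem isSimpleSubtorus_repOf_of_le_fixedSubspace (c : Fin hd.numClasses) (h : (hd.repOf c).1 ≤ fixedSubspace ρ ⊤) :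
    IsSimpleSubtorus Φ (hd.repOf c).1 :=
  (isGSimpleSubtorus_iff_isSimpleSubtorus_of_le_fixedSubspace ρ h).1 (hd.gSimple' _ (hd.repOf c).2)

end IsEquivariantPoincareDecomposition

end ComplexTorus

end Literature.Geometry.Kaehler
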